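import Mathlib

/-!
# LangWeilTransfer, support item `TameResolution` (stmt-ValiantsHypothesis-6378) — the leading
# coefficient of the primitive minimal polynomial of an integral element is a constant

Route `LangWeilTransfer` of `ValiantsHypothesis` (conditional route; honest framing: bookkeeping,
nothing here bears on VP ≠ VNP). The typed `TameResolution` asks for `Q ∈ ℤ[T][U]` with
`(finSuccEquiv ℤ r Q).leadingCoeff = C cQ`, `cQ : ℤ`: in Noether position the primitive element
`u` is INTEGRAL over `ℚ[T̄] ≅ ℚ[T]`, an integrally closed domain, so its minimal polynomial is monic
with coefficients in `ℚ[T]`, and the irreducible `Q` through `u` is a constant multiple of it.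

* `exists_leadingCoeff_eq_C_of_isIntegral` — over `ℚ[T]`: an irreducible `Q ∈ ℚ[T][U]` vanishing
  at an element `u` integral over `ℚ[T]` (along an injective `θ : ℚ[T] → F₀`) has leading
  coefficient `C c`, `c ∈ ℚ ∖ 0`, and divides every `G ∈ ℚ[T][U]` vanishing at `u` (it is a unit
  multiple of the minimal polynomial; `minpoly.isIntegrallyClosed_dvd`);
* `exists_leadingCoeff_eq_C_int` — the integer form: for `Q ∈ ℤ[T][U]` whose image in `ℚ[T][U]`
  is irreducible and vanishes at such a `u`, `Q.leadingCoeff = C c` with `c ∈ ℤ ∖ 0`.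
-/

noncomputable section

open MvPolynomial

-- the summit and the problem share the name `ValiantsHypothesis` (D-0017 single-conjunct layout)
set_option linter.dupNamespace false

namespace Summit.ValiantsHypothesis.ValiantsHypothesis.Theorems.LangWeilTransfer

variable {F₀ : Type*} [Field F₀] {r : ℕ}

/-- **Leading coefficient of an irreducible polynomial through an integral element.** Let
`θ : ℚ[T] → F₀` be injective, `u ∈ F₀` integral over `ℚ[T]` (a monic `p ∈ ℚ[T][U]` with
`p^θ(u) = 0`), and `Q ∈ ℚ[T][U]` irreducible with `Q^θ(u) = 0`. Then `Q = c · minpoly(u)` for a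
unit `c`, so `Q.leadingCoeff = C c` with `c ∈ ℚ`, `c ≠ 0`, and `Q` divides every polynomial
vanishing at `u` (the kernel of the evaluation `ℚ[T][U] → F₀` at `(T̄, u)` is `(Q)`). -/
theorem exists_leadingCoeff_eq_C_of_isIntegral (θ : MvPolynomial (Fin r) ℚ →+* F₀)
    (hθ : Function.Injective θ) (u : F₀)
    (hu : ∃ p : Polynomial (MvPolynomial (Fin r) ℚ), p.Monic ∧ (p.map θ).eval u = 0)
    (Q : Polynomial (MvPolynomial (Fin r) ℚ)) (hQ : Irreducible Q) (hQu : (Q.map θ).eval u = 0) :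
    ∃ c : ℚ, c ≠ 0 ∧ Q.leadingCoeff = C c ∧
      ∀ G : Polynomial (MvPolynomial (Fin r) ℚ), (G.map θ).eval u = 0 → Q ∣ G := by
  classical
  letI : Algebra (MvPolynomial (Fin r) ℚ) F₀ := θ.toAlgebra
  have halg : algebraMap (MvPolynomial (Fin r) ℚ) F₀ = θ := rfl
  haveI : Module.IsTorsionFree (MvPolynomial (Fin r) ℚ) F₀ :=
    Module.isTorsionFree_iff_algebraMap_injective.2 hθ
  -- `u` is integral
  obtain ⟨p, hpm, hpu⟩ := hu
  have hint : IsIntegral (MvPolynomial (Fin r) ℚ) u := by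
    refine ⟨p, hpm, ?_⟩
    rw [← Polynomial.eval_map, halg]; exact hpu
  -- the minimal polynomial divides `Q`
  have hQaeval : Polynomial.aeval u Q = 0 := by
    rw [Polynomial.aeval_def, ← Polynomial.eval_map, halg]; exact hQu
  obtain ⟨h, hh⟩ := minpoly.isIntegrallyClosed_dvd hint hQaeval
  -- `Q` irreducible, `minpoly` not a unit ⇒ `h` is a unit, i.e. a non-zero constant
  have hunit : IsUnit h := by
    rcases hQ.isUnit_or_isUnit hh with h1 | h2
    · exact absurd h1 (minpoly.not_isUnit (MvPolynomial (Fin r) ℚ) u)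
    · exact h2
  obtain ⟨b, hb, hbh⟩ := Polynomial.isUnit_iff.1 hunit
  obtain ⟨c, hc, hbc⟩ := (MvPolynomial.isUnit_iff_eq_C_of_isReduced (P := b)).1 hb
  refine ⟨c, hc.ne_zero, ?_, ?_⟩
  · rw [hh, ← hbh, hbc, Polynomial.leadingCoeff_mul, (minpoly.monic hint).leadingCoeff, one_mul,
      Polynomial.leadingCoeff_C]
  · -- kernel: `minpoly ∣ G` and `Q = minpoly · unit`
    intro G hG
    have hGaeval : Polynomial.aeval u G = 0 := by
      rw [Polynomial.aeval_def, ← Polynomial.eval_map, halg]; exact hG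
    have hmin : minpoly (MvPolynomial (Fin r) ℚ) u ∣ G := minpoly.isIntegrallyClosed_dvd hint hGaeval
    have hQmin : Q * Polynomial.C (C c⁻¹) = minpoly (MvPolynomial (Fin r) ℚ) u := by
      rw [hh, ← hbh, hbc, mul_assoc, ← Polynomial.C_mul, ← C_mul, mul_inv_cancel₀ hc.ne_zero, C_1,
        Polynomial.C_1, mul_one]
    rw [← hQmin] at hmin
    exact (dvd_mul_right Q _).trans hmin

/-- An integer polynomial in `T` whose image in `ℚ[T]` is a constant is an integer constant. -/
theorem exists_eq_C_int_of_map_eq_C {b : MvPolynomial (Fin r) ℤ} {c : ℚ}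
    (h : MvPolynomial.map (Int.castRingHom ℚ) b = C c) : ∃ z : ℤ, b = C z ∧ (z : ℚ) = c := by
  classical
  refine ⟨b.coeff 0, ?_, ?_⟩
  · ext m
    rw [coeff_C]
    split_ifs with hm
    · rw [← hm]
    · have := congrArg (coeff m) h
      rw [coeff_map, coeff_C, if_neg hm, eq_intCast, Int.cast_eq_zero] at this
      exact this
  · have := congrArg (coeff 0) h
    rw [coeff_map, coeff_C, if_pos rfl, eq_intCast] at this
    exact this

/-- **Integer form.** Let `θ : ℤ[T] → F₀` with `ℚ[T] → F₀` (its extension `θℚ`) injective, `u`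
integral over `ℚ[T]` along `θℚ`, and `Q ∈ ℤ[T][U]` whose image `Qℚ ∈ ℚ[T][U]` is irreducible and
vanishes at `u`. Then `Q.leadingCoeff = C c` for an integer `c ≠ 0`. -/
theorem exists_leadingCoeff_eq_C_int (θℚ : MvPolynomial (Fin r) ℚ →+* F₀)
    (hθ : Function.Injective θℚ) (u : F₀)
    (hu : ∃ p : Polynomial (MvPolynomial (Fin r) ℚ), p.Monic ∧ (p.map θℚ).eval u = 0)
    (Q : Polynomial (MvPolynomial (Fin r) ℤ))
    (hQ : Irreducible (Q.map (MvPolynomial.map (Int.castRingHom ℚ))))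
    (hQu : ((Q.map (MvPolynomial.map (Int.castRingHom ℚ))).map θℚ).eval u = 0) :
    ∃ c : ℤ, c ≠ 0 ∧ Q.leadingCoeff = C c := by
  obtain ⟨c, hc, hlc, -⟩ := exists_leadingCoeff_eq_C_of_isIntegral θℚ hθ u hu _ hQ hQu
  rw [Polynomial.leadingCoeff_map_of_injective
    (MvPolynomial.map_injective _ (RingHom.injective_int (Int.castRingHom ℚ)))] at hlc
  obtain ⟨z, hz, hzc⟩ := exists_eq_C_int_of_map_eq_C hlc
  refine ⟨z, ?_, hz⟩
  rintro rfl
  rw [Int.cast_zero] at hzc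
  exact hc hzc.symm

end Summit.ValiantsHypothesis.ValiantsHypothesis.Theorems.LangWeilTransfer
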